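import Summits.Ventures.HodgeRepro2.T5SU11LegendreBound

/-!
# The derivative of `P_n` as a positive combination of lower Legendre polynomials, and Markov's bound
`|P'_n(x)| ≤ n(n + 1)/2 = P'_n(1)` on `[−1, 1]`

Row 382's identity `P'_{n+2} − P'_n = (2n + 3) P_{n+1}` (`T5SU11LegendreIdentities.legQ_succ_succ_sub_legQ`) telescopes
along the parity classes:

  **`P'_{2m} = Σ_{j<m} (4j + 3) P_{2j+1}`**,  **`P'_{2m+1} = Σ_{j≤m} (4j + 1) P_{2j}`**   (`legQ_even_eq_sum`, `legQ_odd_eq_sum`),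

all coefficients positive and summing to `n(n + 1)/2`, so with `P_k(1) = 1` and `|P_k| ≤ 1` on `[−1, 1]` (row 385):

  **`P'_n(1) = n(n + 1)/2`**, **`P'_n(−1) = (−1)^{n+1} n(n + 1)/2`**   (`legQ_one_eq`, `legQ_neg_one_eq`),
  **`|P'_n(x)| ≤ n(n + 1)/2` on `[−1, 1]`**, i.e. `|P'_n(x)| ≤ P'_n(1)`   (`abs_legQ_le`, `abs_legQ_le_legQ_one`),

the Markov–Bernstein bound for the Legendre polynomials, sharp at `x = ±1`; also `P'_n(x) > 0` on `[1, ∞)` for `n ≥ 1`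
(`legQ_pos_of_one_le`) and the parity `P'_n(−x) = (−1)^{n+1} P'_n(x)` (`legQ_neg`). Nothing is claimed about (N).

Blind lane: Mathlib + the HodgeRepro2 prefix only; no sorry; axioms ⊆ {propext, Classical.choice,
Quot.sound}.
-/

namespace Summit.Ventures.HodgeRepro2.T5SU11LegendreDerivativeSum

open Finset Set
open T5SU11SphericalLegendreAll T5SU11SphericalLegendreLaplace T5SU11LegendreIdentities T5SU11LegendreBound

/-! ### The telescoped derivative -/

/-- **`P'_{2m} = Σ_{j<m} (4j + 3) P_{2j+1}`.** -/
theorem legQ_even_eq_sum (m : ℕ) (x : ℝ) :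
    legQ (2 * m) x = ∑ j ∈ range m, (4 * (j : ℝ) + 3) * legP (2 * j + 1) x := by
  induction m with
  | zero => simp
  | succ m ih =>
    have h := legQ_succ_succ_sub_legQ (2 * m) x
    rw [Finset.sum_range_succ, ← ih, show 2 * (m + 1) = 2 * m + 2 by ring]
    push_cast at h ⊢
    linear_combination h

/-- **`P'_{2m+1} = Σ_{j≤m} (4j + 1) P_{2j}`.** -/
theorem legQ_odd_eq_sum (m : ℕ) (x : ℝ) :
    legQ (2 * m + 1) x = ∑ j ∈ range (m + 1), (4 * (j : ℝ) + 1) * legP (2 * j) x := by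
  induction m with
  | zero => simp
  | succ m ih =>
    have h := legQ_succ_succ_sub_legQ (2 * m + 1) x
    rw [Finset.sum_range_succ, ← ih, show 2 * (m + 1) + 1 = 2 * m + 1 + 2 by ring,
      show 2 * (m + 1) = 2 * m + 1 + 1 by ring]
    push_cast at h ⊢
    linear_combination h

/-- `Σ_{j<m} (4j + 3) = 2m² + m = (2m)(2m + 1)/2`. -/
theorem sum_coeff_even (m : ℕ) : ∑ j ∈ range m, (4 * (j : ℝ) + 3) = 2 * (m : ℝ) ^ 2 + m := by
  induction m with
  | zero => simp
  | succ m ih =>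
    rw [Finset.sum_range_succ, ih]
    push_cast
    ring

/-- `Σ_{j≤m} (4j + 1) = (m + 1)(2m + 1) = (2m + 1)(2m + 2)/2`. -/
theorem sum_coeff_odd (m : ℕ) : ∑ j ∈ range (m + 1), (4 * (j : ℝ) + 1) = ((m : ℝ) + 1) * (2 * m + 1) := by
  induction m with
  | zero => simp
  | succ m ih =>
    rw [Finset.sum_range_succ, ih]
    push_cast
    ring

/-! ### The values at `±1` -/

/-- **`P'_n(1) = n(n + 1)/2`.** -/
theorem legQ_one_eq (n : ℕ) : legQ n 1 = (n : ℝ) * (n + 1) / 2 := by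
  rcases Nat.even_or_odd' n with ⟨m, rfl | rfl⟩
  · rw [legQ_even_eq_sum]
    simp only [legP_one, mul_one]
    rw [sum_coeff_even]
    push_cast
    ring
  · rw [legQ_odd_eq_sum]
    simp only [legP_one, mul_one]
    rw [sum_coeff_odd]
    push_cast
    ring

/-- **The parity of the derivative**: `P'_n(−x) = (−1)^{n+1} P'_n(x)`. -/
theorem legQ_neg (n : ℕ) (x : ℝ) : legQ n (-x) = (-1) ^ (n + 1) * legQ n x := by
  have h1 : HasDerivAt (fun y => legP n (-y)) (legQ n (-x) * (-1)) x :=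
    (hasDerivAt_legP n (-x)).comp x (hasDerivAt_neg x)
  have h2 : HasDerivAt (fun y => legP n (-y)) ((-1) ^ n * legQ n x) x := by
    have e : (fun y => legP n (-y)) = fun y => (-1) ^ n * legP n y := funext fun y => legP_neg n y
    rw [e]
    exact (hasDerivAt_legP n x).const_mul _
  have := h1.unique h2
  rw [pow_succ]
  linear_combination -this

/-- **`P'_n(−1) = (−1)^{n+1} n(n + 1)/2`.** -/
theorem legQ_neg_one_eq (n : ℕ) : legQ n (-1) = (-1) ^ (n + 1) * ((n : ℝ) * (n + 1) / 2) := by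
  rw [legQ_neg, legQ_one_eq]

/-! ### Markov's bound -/

/-- **`|P'_n(x)| ≤ n(n + 1)/2` on `[−1, 1]`** (Markov's inequality for the Legendre polynomials). -/
theorem abs_legQ_le (n : ℕ) {x : ℝ} (hx : x ∈ Icc (-1 : ℝ) 1) : |legQ n x| ≤ (n : ℝ) * (n + 1) / 2 := by
  rcases Nat.even_or_odd' n with ⟨m, rfl | rfl⟩
  · rw [legQ_even_eq_sum]
    calc |∑ j ∈ range m, (4 * (j : ℝ) + 3) * legP (2 * j + 1) x|
        ≤ ∑ j ∈ range m, |(4 * (j : ℝ) + 3) * legP (2 * j + 1) x| := Finset.abs_sum_le_sum_abs _ _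
      _ ≤ ∑ j ∈ range m, (4 * (j : ℝ) + 3) := by
          refine Finset.sum_le_sum fun j _ => ?_
          rw [abs_mul, abs_of_nonneg (by positivity)]
          exact mul_le_of_le_one_right (by positivity) (abs_legP_le_one _ hx)
      _ = ((2 * m : ℕ) : ℝ) * ((2 * m : ℕ) + 1) / 2 := by rw [sum_coeff_even]; push_cast; ring
  · rw [legQ_odd_eq_sum]
    calc |∑ j ∈ range (m + 1), (4 * (j : ℝ) + 1) * legP (2 * j) x|
        ≤ ∑ j ∈ range (m + 1), |(4 * (j : ℝ) + 1) * legP (2 * j) x| := Finset.abs_sum_le_sum_abs _ _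
      _ ≤ ∑ j ∈ range (m + 1), (4 * (j : ℝ) + 1) := by
          refine Finset.sum_le_sum fun j _ => ?_
          rw [abs_mul, abs_of_nonneg (by positivity)]
          exact mul_le_of_le_one_right (by positivity) (abs_legP_le_one _ hx)
      _ = ((2 * m + 1 : ℕ) : ℝ) * ((2 * m + 1 : ℕ) + 1) / 2 := by rw [sum_coeff_odd]; push_cast; ring

/-- **`|P'_n(x)| ≤ P'_n(1)` on `[−1, 1]`**: the derivative is extremal at the endpoint. -/
theorem abs_legQ_le_legQ_one (n : ℕ) {x : ℝ} (hx : x ∈ Icc (-1 : ℝ) 1) : |legQ n x| ≤ legQ n 1 := by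
  rw [legQ_one_eq]
  exact abs_legQ_le n hx

/-- **`P'_n(x) > 0` on `[1, ∞)`** for `n ≥ 1` (every term of the telescoped sum is `≥ 1`). -/
theorem legQ_pos_of_one_le {n : ℕ} (hn : 1 ≤ n) {x : ℝ} (hx : 1 ≤ x) : 0 < legQ n x := by
  letI : MeasurableSpace Circle := borel Circle
  haveI : BorelSpace Circle := ⟨rfl⟩
  rcases Nat.even_or_odd' n with ⟨m, rfl | rfl⟩
  · rw [legQ_even_eq_sum]
    have hm : 0 < m := by omega
    refine Finset.sum_pos (fun j _ => ?_) ⟨0, Finset.mem_range.mpr hm⟩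
    have := one_le_legP (2 * j + 1) hx
    positivity
  · rw [legQ_odd_eq_sum]
    refine Finset.sum_pos (fun j _ => ?_) ⟨0, Finset.mem_range.mpr (Nat.succ_pos m)⟩
    have := one_le_legP (2 * j) hx
    positivity

/-- **`P'_n(x) ≥ P'_n(1) = n(n + 1)/2` on `[1, ∞)`** (each `P_k ≥ 1` there). -/
theorem legQ_one_le_legQ (n : ℕ) {x : ℝ} (hx : 1 ≤ x) : legQ n 1 ≤ legQ n x := by
  letI : MeasurableSpace Circle := borel Circle
  haveI : BorelSpace Circle := ⟨rfl⟩
  rcases Nat.even_or_odd' n with ⟨m, rfl | rfl⟩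
  · rw [legQ_even_eq_sum, legQ_even_eq_sum]
    refine Finset.sum_le_sum fun j _ => ?_
    rw [legP_one]
    exact mul_le_mul_of_nonneg_left (one_le_legP _ hx) (by positivity)
  · rw [legQ_odd_eq_sum, legQ_odd_eq_sum]
    refine Finset.sum_le_sum fun j _ => ?_
    rw [legP_one]
    exact mul_le_mul_of_nonneg_left (one_le_legP _ hx) (by positivity)

end Summit.Ventures.HodgeRepro2.T5SU11LegendreDerivativeSum
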